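import Summits.QuantumFields.BalabanUV.Beta.GAN24.CombHalfMemberSlavedDivergenceLetters
import Summits.QuantumFields.BalabanUV.Beta.GAN24.HalfMemberSlavedDivergenceDrift

/-!
# `BalabanUV.Beta.GAN24.CombHalfMemberSlavedDivergenceDrift` — binder row G-an2-4 ∕ (CONV-C), TRANSFER-III (the (α-0) chain at row D1's literal of record (III′)), link L8b′,
# PART 6′ of `CombHalfMemberSlavedDivergence` (the DRIFT twin): **THE TWO SLOT-DIVERGENCE LETTER ROWS OF THE COMB-CHART `ε`-MEMBER's ONE-STEP DIFFERENCE `y_{l+2} − y_{l+1}`**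
# — the (b1)-side input of leaf-03's (C-6d) `CombHalfMemberCellDriftOfDivergences` («the eight rows on `Z_{l+1} − Z_l`») for the OWNER gan24-p1 g46's displayed drift row
# `hcelld` of T5 `CombT2DriftEvenEnd` — FROM road-P2's (F4b) one-step drift row of the dressed comb-chart source and the DIFFERENCES of the slaved `e3OfK` summands at two
# consecutive levels (displayed); MY lineage's (E) file `HalfMemberSlavedDivergenceDrift` (gen 72; in the (α-0) END's import closure via `T2DriftHalfMemberOfLetterRows`)
# RE-RUN at the sym ∕ comb slot data (G-an2-4 CRUX TEAM (2), leaf prover `b2b-balaban-gan24-formalise-leaf-01`, gen 80; R-gan24p1-g46-2 row «L8b–L9»; no existing file touched)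

NOT IN PRINT; OUR BOOKKEEPING ([folklore] composition BY NAME; statements = MY lineage's (E) file's with `(coDressKBmAt ρ Lc (KInvStep Lc ·), T2RecAt ρ, SpureRecAt ρ, M1At ρ cΛ,
vh₂S, mixFFAt ρ Lc) ↦ (GcombSh Lc ·, T2RecOf … (GcombSh Lc) (SpureCombOf tabs …) tabs.M …, SpureCombOf tabs, tabs.M, tabs.vh₂S, tabs.mixFF)`, root binders `hLc hr` and the border
class `hB` ↦ the record `tabs : SymTables d Lc`; proofs token for token; 0 `def`, 0 cited facts, 0 `def … : Prop`, 0 sorry).  HONEST FRAMING (cell contract, verbatim): «discharging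
`BetaPertH` makes Bałaban's UV stability UNCONDITIONAL — a real constructive-QFT result; it is NOT the continuum limit and NOT the Clay problem.»  HONEST DEPENDENCY (verbatim):
«continuum YM on T⁴ ⇐ BetaPertH ∧ nine spine estimates (0/9 proved); BetaPertH ⇐ (D1) ∧ (D4) ∧ CAP+tail; G-an2-4 gates asym, D1 and NE2/3/4.»

WHAT (levels `l → l+1` and `l+1 → l+2`; every `ε` with `|ε| ≤ 1`, rate `0 ≤ δ`; letters at the two levels `S₀ R₀ R₀″ cH₀` (laws of `T̃′_l`) and `S₁ R₁ R₁″ cH₁` (laws of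
`T̃′_{l+1}`), shared generator `X`, parities `hC₀ hR₀ hR₀″ hC₁ hR₁ hR₁″`; any record `tabs : SymTables d Lc` with off-diagonal border; generic `d`):
**`slotLetters_halfMember_comb_succ_sub_of_rows`** — HYPOTHESES: (i′) road-P2's (F4b) one-step drift row of the dressed comb-chart source `hbF4d : LocStencil₂ (b̃′♮_{l+1} − b̃′♮_l) Cbd δ`;
(ii′) TWO DISPLAYED rows on the DIFFERENCE of the slaved summand tables `E_{l+1}(p) − E_l(p)` (passive reading `hEd₁`, active reading `hEd₂`; `E_m(p)` as in PART 4′ with the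
level-`m` letters); CONCLUSION: leaf-03's `h₁ ∧ h₂` rows for `Y := y_{l+2} − y_{l+1}` with constants `(d+1)(e^{3δ}+1)·Cbd + CEd₁` and `(d+1)(e^{δ}+1)·Cbd + CEd₂` — PART 2′'s slaved
identities at BOTH levels, MY (E) §0 `divV_fst_sub ∕ half_sub` (table-generic, BY NAME from `HalfMemberSlavedDivergenceDrift`), the OWNER's `locStencil₂_halfTable`, leaf-02's letters,
`locStencil₂_add`; the consumer puts `Cbd := Cbd′·θ^l`, `CEd := CEd′·θ^l`.
WHAT THIS IS NOT.  Rows (i)(ii) ∕ (i′)(ii′), the table laws and the parities are DISPLAYED HYPOTHESES; NOT the cells `hcell ∕ hcelld` (leaf-03 g79∕g80's (C-6) ∕ (C-6d)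
`CombHalfMemberCell(Drift)OfDivergences` CONSUME these rows for ANY `Z l`), NOT one row of the S-∕W-slot, NO value, NO rate; asserts NOTHING about Bałaban's tables; the
(III′) campaign is NOT asked (an2 W-4 l.64553) — zero weight; NEVER «G-an2-4 closed» as (CONV-C); NOT D1, NOT `BetaPertH`, NOT continuum, NOT Clay.  2026-08-25.
-/

noncomputable section

open Finset
open scoped BigOperators
open Literature.MathematicalPhysics.QuantumFieldTheory
open Literature.MathematicalPhysics.QuantumFieldTheory.Balaban1983to89
open Literature.MathematicalPhysics.QuantumFieldTheory.Balaban1983to89.Beta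
open ExpKernelCalculus (MKer Decays comp)
open OneStepResolventKernel (Fib)
open SecondOrderResponse (W2SymOfK)
open BalabanStepJetsSucc (mmRead)
open BalabanStepW2 (K3OfK M2Of)
open KernelWard (divV divW)
open AffineAveraging (box toSite unitVec)
open BalabanCompositeJets (LocStencil₂)
open Summit.QuantumFields.BalabanUV.Beta.TameKernelCalculus (trK)
open Summit.QuantumFields.BalabanUV.Beta.BorderedHessian (sgnK)
open Summit.QuantumFields.BalabanUV.Beta.HessKerDressedUnits (unitK unitS)
open Summit.QuantumFields.BalabanUV.Beta.SecondOrderUnits (unitM unitS₂ unitM₂)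
open Summit.QuantumFields.BalabanUV.Beta.SymmetrisedStepJets (SymTables)
open Summit.QuantumFields.BalabanUV.Beta.CombChartStepJets (GcombSh SpureCombOf)
open Summit.QuantumFields.BalabanUV.Beta.SpineRooted (T2RecOf e3OfK)
open Summit.QuantumFields.BalabanUV.Beta.GAN24.CombesThomas (sfStep smStep)
open Summit.QuantumFields.BalabanUV.Beta.GAN24.BiStencilZeroMode (Tab)
open Summit.QuantumFields.BalabanUV.Beta.GAN24.WSlotT2OfPieces (locStencil₂_add)
open Summit.QuantumFields.BalabanUV.Beta.GAN24.SlotDivergenceLetters (letter_fst_of_locStencil₂ letter_snd_of_locStencil₂)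
open Summit.QuantumFields.BalabanUV.Beta.GAN24.T2ShapeEvenEnd (locStencil₂_halfTable)
open Summit.QuantumFields.BalabanUV.Beta.GAN24.HalfMemberSlavedDivergenceDrift (divV_fst_sub half_sub)
open Summit.QuantumFields.BalabanUV.Beta.GAN24.CombHalfMemberSlavedDivergenceLaws (divW_halfMember_comb_succ_eq_slaved divV_snd_halfMember_comb_succ_eq_slaved)

namespace Summit.QuantumFields.BalabanUV.Beta.GAN24.CombHalfMemberSlavedDivergenceDrift

variable {d : ℕ} {Lc : ℕ} [NeZero Lc]

/-! ## §1 The slot letters of the one-step difference of the comb-chart `ε`-member -/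

/-- NOT IN PRINT; OUR BOOKKEEPING.  **THE SLOT LETTERS OF THE COMB-CHART `ε`-MEMBER's ONE-STEP DIFFERENCE** (leaf-03 g66's `h₁ ∕ h₂` spellings for `Y := y_{l+2} − y_{l+1}`): from the
dressed source's one-step drift row (halved: the OWNER's `locStencil₂_halfTable` ⨾ MY (E) §0 `half_sub`; leaf-02's ι-WIN letters) and the two displayed rows on the difference of the
slaved summand tables at levels `l+1` and `l` (PART 2′ at both levels; MY (E) §0 linearity BY NAME; `locStencil₂_add`).  The twin of MY g72 `slotLetters_halfMember_succ_sub_of_rows`. -/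
theorem slotLetters_halfMember_comb_succ_sub_of_rows (tabs : SymTables d Lc) (cE cVH cΛ cE₂ cB : ℝ) (Tc : Fin 4 → Fin 4 → Fin 4 → Fin 4 → ℝ)
    (hBff : ∀ κ u κ' u' x z (α β : Fin (d + 1)), tabs.vh₂S κ u κ' u' x z (Sum.inl α) (Sum.inl β) = 0)
    (hBmm : ∀ κ u κ' u' x z (μ ν : Fin (d + 1)), tabs.vh₂S κ u κ' u' x z (Sum.inr μ) (Sum.inr ν) = 0) (l : ℕ)
    {X : (Fin (d + 1) → ℤ) → MKer (d + 1) (Fib d)}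
    {S₀ : Fin (d + 1) → (Fin (d + 1) → ℤ) → MKer (d + 1) (Fib d)}
    {R₀ R₀'' : (Fin (d + 1) → ℤ) → Fin (d + 1) → (Fin (d + 1) → ℤ) → MKer (d + 1) (Fib d)} {cH₀ : ℝ} (hcH₀ : cH₀ ≠ 0)
    (hTL₀ : ∀ (Y : Fin (d + 1) → ℤ) (κ' : Fin (d + 1)) (u' : Fin (d + 1) → ℤ),
      cH₀ • ∑ v ∈ box (d + 1) Lc, divV (fun κ u => T2RecOf d Lc (GcombSh Lc) (SpureCombOf tabs cE cVH cΛ) tabs.M cE₂ cB Tc tabs.vh₂S tabs.mixFF l κ u κ' u') ((Lc : ℤ) • Y + toSite v)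
        = comp (S₀ κ' u') (X Y) - comp (X Y) (S₀ κ' u') + R₀ Y κ' u')
    (hTL₀'' : ∀ (Y : Fin (d + 1) → ℤ) (κ : Fin (d + 1)) (u : Fin (d + 1) → ℤ),
      cH₀ • ∑ v ∈ box (d + 1) Lc, divV (T2RecOf d Lc (GcombSh Lc) (SpureCombOf tabs cE cVH cΛ) tabs.M cE₂ cB Tc tabs.vh₂S tabs.mixFF l κ u) ((Lc : ℤ) • Y + toSite v)
        = comp (S₀ κ u) (X Y) - comp (X Y) (S₀ κ u) + R₀'' Y κ u)
    (hC₀ : ∀ (Y : Fin (d + 1) → ℤ) (κ : Fin (d + 1)) (u : Fin (d + 1) → ℤ),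
      trK (comp (S₀ κ u) (X Y) - comp (X Y) (S₀ κ u)) = sgnK (comp (S₀ κ u) (X Y) - comp (X Y) (S₀ κ u)))
    (hR₀ : ∀ (Y : Fin (d + 1) → ℤ) (κ : Fin (d + 1)) (u : Fin (d + 1) → ℤ), trK (R₀ Y κ u) = -sgnK (R₀ Y κ u))
    (hR₀'' : ∀ (Y : Fin (d + 1) → ℤ) (κ : Fin (d + 1)) (u : Fin (d + 1) → ℤ), trK (R₀'' Y κ u) = -sgnK (R₀'' Y κ u))
    {S₁ : Fin (d + 1) → (Fin (d + 1) → ℤ) → MKer (d + 1) (Fib d)}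
    {R₁ R₁'' : (Fin (d + 1) → ℤ) → Fin (d + 1) → (Fin (d + 1) → ℤ) → MKer (d + 1) (Fib d)} {cH₁ : ℝ} (hcH₁ : cH₁ ≠ 0)
    (hTL₁ : ∀ (Y : Fin (d + 1) → ℤ) (κ' : Fin (d + 1)) (u' : Fin (d + 1) → ℤ),
      cH₁ • ∑ v ∈ box (d + 1) Lc, divV (fun κ u => T2RecOf d Lc (GcombSh Lc) (SpureCombOf tabs cE cVH cΛ) tabs.M cE₂ cB Tc tabs.vh₂S tabs.mixFF (l + 1) κ u κ' u') ((Lc : ℤ) • Y + toSite v)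
        = comp (S₁ κ' u') (X Y) - comp (X Y) (S₁ κ' u') + R₁ Y κ' u')
    (hTL₁'' : ∀ (Y : Fin (d + 1) → ℤ) (κ : Fin (d + 1)) (u : Fin (d + 1) → ℤ),
      cH₁ • ∑ v ∈ box (d + 1) Lc, divV (T2RecOf d Lc (GcombSh Lc) (SpureCombOf tabs cE cVH cΛ) tabs.M cE₂ cB Tc tabs.vh₂S tabs.mixFF (l + 1) κ u) ((Lc : ℤ) • Y + toSite v)
        = comp (S₁ κ u) (X Y) - comp (X Y) (S₁ κ u) + R₁'' Y κ u)
    (hC₁ : ∀ (Y : Fin (d + 1) → ℤ) (κ : Fin (d + 1)) (u : Fin (d + 1) → ℤ),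
      trK (comp (S₁ κ u) (X Y) - comp (X Y) (S₁ κ u)) = sgnK (comp (S₁ κ u) (X Y) - comp (X Y) (S₁ κ u)))
    (hR₁ : ∀ (Y : Fin (d + 1) → ℤ) (κ : Fin (d + 1)) (u : Fin (d + 1) → ℤ), trK (R₁ Y κ u) = -sgnK (R₁ Y κ u))
    (hR₁'' : ∀ (Y : Fin (d + 1) → ℤ) (κ : Fin (d + 1)) (u : Fin (d + 1) → ℤ), trK (R₁'' Y κ u) = -sgnK (R₁'' Y κ u))
    (ε : ℝ) (hε : |ε| ≤ 1) {Cbd CEd₁ δ : ℝ} (hδ : 0 ≤ δ)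
    (hbF4d : LocStencil₂ ((fun κ u κ' u' => (cE₂ * (Lc : ℝ) ^ (2 * (d + 1))) • mmRead Lc (K3OfK
            (unitK (sfStep Lc (l + 1)) (smStep d Lc (l + 1)) (GcombSh (d := d) Lc (l + 1))) Lc
            (unitS (sfStep Lc (l + 1)) (smStep d Lc (l + 1)) (SpureCombOf tabs cE cVH cΛ (l + 1))) (unitM (sfStep Lc (l + 1)) (smStep d Lc (l + 1)) (tabs.M (l + 1)))
            (W2SymOfK (unitK (sfStep Lc (l + 1)) (smStep d Lc (l + 1)) (GcombSh (d := d) Lc (l + 1))) Lc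
              (unitS (sfStep Lc (l + 1)) (smStep d Lc (l + 1)) (SpureCombOf tabs cE cVH cΛ (l + 1))) (unitM (sfStep Lc (l + 1)) (smStep d Lc (l + 1)) (tabs.M (l + 1))) 0
              (unitM₂ (sfStep Lc (l + 1)) (smStep d Lc (l + 1)) (M2Of d Lc tabs.mixFF (l + 1)))) κ u κ' u') + cB • tabs.vh₂S κ u κ' u')
      - (fun κ u κ' u' => (cE₂ * (Lc : ℝ) ^ (2 * (d + 1))) • mmRead Lc (K3OfK
            (unitK (sfStep Lc l) (smStep d Lc l) (GcombSh (d := d) Lc l)) Lc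
            (unitS (sfStep Lc l) (smStep d Lc l) (SpureCombOf tabs cE cVH cΛ l)) (unitM (sfStep Lc l) (smStep d Lc l) (tabs.M l))
            (W2SymOfK (unitK (sfStep Lc l) (smStep d Lc l) (GcombSh (d := d) Lc l)) Lc
              (unitS (sfStep Lc l) (smStep d Lc l) (SpureCombOf tabs cE cVH cΛ l)) (unitM (sfStep Lc l) (smStep d Lc l) (tabs.M l)) 0
              (unitM₂ (sfStep Lc l) (smStep d Lc l) (M2Of d Lc tabs.mixFF l))) κ u κ' u') + cB • tabs.vh₂S κ u κ' u')) Cbd δ)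
    (hEd₁ : LocStencil₂ (fun (_ : Fin (d + 1)) (p : Fin (d + 1) → ℤ) (κ' : Fin (d + 1)) (u' : Fin (d + 1) → ℤ) =>
          (cE₂ * (Lc : ℝ) ^ (2 * (d + 1)) * ((Lc : ℝ) ^ (d + 1))⁻¹ / 2) •
            (e3OfK Lc (unitK (sfStep Lc (l + 1)) (smStep d Lc (l + 1)) (GcombSh (d := d) Lc (l + 1)))
              (fun κ' u' => (sfStep Lc (l + 1) * smStep d Lc (l + 1))⁻¹ • unitS (sfStep Lc (l + 1)) (smStep d Lc (l + 1))
                (fun κ' u' => cH₁⁻¹ • ((((1 : ℝ) + ε) / 2) • (comp (S₁ κ' u') (X p) - comp (X p) (S₁ κ' u')) + (((1 : ℝ) - ε) / 2) • R₁ p κ' u')) κ' u') κ' u'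
            + e3OfK Lc (unitK (sfStep Lc (l + 1)) (smStep d Lc (l + 1)) (GcombSh (d := d) Lc (l + 1)))
              (fun κ u => (sfStep Lc (l + 1) * smStep d Lc (l + 1))⁻¹ • unitS (sfStep Lc (l + 1)) (smStep d Lc (l + 1))
                (fun κ u => cH₁⁻¹ • ((((1 : ℝ) + ε) / 2) • (comp (S₁ κ u) (X p) - comp (X p) (S₁ κ u)) + (((1 : ℝ) - ε) / 2) • R₁'' p κ u)) κ u) κ' u')
        - (cE₂ * (Lc : ℝ) ^ (2 * (d + 1)) * ((Lc : ℝ) ^ (d + 1))⁻¹ / 2) •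
            (e3OfK Lc (unitK (sfStep Lc l) (smStep d Lc l) (GcombSh (d := d) Lc l))
              (fun κ' u' => (sfStep Lc l * smStep d Lc l)⁻¹ • unitS (sfStep Lc l) (smStep d Lc l)
                (fun κ' u' => cH₀⁻¹ • ((((1 : ℝ) + ε) / 2) • (comp (S₀ κ' u') (X p) - comp (X p) (S₀ κ' u')) + (((1 : ℝ) - ε) / 2) • R₀ p κ' u')) κ' u') κ' u'
            + e3OfK Lc (unitK (sfStep Lc l) (smStep d Lc l) (GcombSh (d := d) Lc l))
              (fun κ u => (sfStep Lc l * smStep d Lc l)⁻¹ • unitS (sfStep Lc l) (smStep d Lc l)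
                (fun κ u => cH₀⁻¹ • ((((1 : ℝ) + ε) / 2) • (comp (S₀ κ u) (X p) - comp (X p) (S₀ κ u)) + (((1 : ℝ) - ε) / 2) • R₀'' p κ u)) κ u) κ' u')) CEd₁ δ) :
    LocStencil₂ (fun (_ : Fin (d + 1)) (p : Fin (d + 1) → ℤ) (κ' : Fin (d + 1)) (u' : Fin (d + 1) → ℤ) =>
        divV (fun κ₁ u₁ => (((1 / 2 : ℝ) • (unitS₂ (sfStep Lc (l + 1 + 1)) (smStep d Lc (l + 1 + 1)) (T2RecOf d Lc (GcombSh Lc) (SpureCombOf tabs cE cVH cΛ) tabs.M cE₂ cB Tc tabs.vh₂S tabs.mixFF (l + 1 + 1))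
          + ε • fun κ u κ' u' => sgnK (trK (unitS₂ (sfStep Lc (l + 1 + 1)) (smStep d Lc (l + 1 + 1)) (T2RecOf d Lc (GcombSh Lc) (SpureCombOf tabs cE cVH cΛ) tabs.M cE₂ cB Tc tabs.vh₂S tabs.mixFF (l + 1 + 1)) κ u κ' u'))))
        - ((1 / 2 : ℝ) • (unitS₂ (sfStep Lc (l + 1)) (smStep d Lc (l + 1)) (T2RecOf d Lc (GcombSh Lc) (SpureCombOf tabs cE cVH cΛ) tabs.M cE₂ cB Tc tabs.vh₂S tabs.mixFF (l + 1))
          + ε • fun κ u κ' u' => sgnK (trK (unitS₂ (sfStep Lc (l + 1)) (smStep d Lc (l + 1)) (T2RecOf d Lc (GcombSh Lc) (SpureCombOf tabs cE cVH cΛ) tabs.M cE₂ cB Tc tabs.vh₂S tabs.mixFF (l + 1)) κ u κ' u'))))) κ₁ u₁ κ' u') p)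
      (((d : ℝ) + 1) * (Real.exp (3 * δ) + 1) * Cbd + CEd₁) δ := by
  -- the halved sources' one-step difference keeps (F4b)'s constant
  have hbd : LocStencil₂ (((1 / 2 : ℝ) • ((fun κ u κ' u' => (cE₂ * (Lc : ℝ) ^ (2 * (d + 1))) • mmRead Lc (K3OfK
            (unitK (sfStep Lc (l + 1)) (smStep d Lc (l + 1)) (GcombSh (d := d) Lc (l + 1))) Lc
            (unitS (sfStep Lc (l + 1)) (smStep d Lc (l + 1)) (SpureCombOf tabs cE cVH cΛ (l + 1))) (unitM (sfStep Lc (l + 1)) (smStep d Lc (l + 1)) (tabs.M (l + 1)))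
            (W2SymOfK (unitK (sfStep Lc (l + 1)) (smStep d Lc (l + 1)) (GcombSh (d := d) Lc (l + 1))) Lc
              (unitS (sfStep Lc (l + 1)) (smStep d Lc (l + 1)) (SpureCombOf tabs cE cVH cΛ (l + 1))) (unitM (sfStep Lc (l + 1)) (smStep d Lc (l + 1)) (tabs.M (l + 1))) 0
              (unitM₂ (sfStep Lc (l + 1)) (smStep d Lc (l + 1)) (M2Of d Lc tabs.mixFF (l + 1)))) κ u κ' u') + cB • tabs.vh₂S κ u κ' u')
          + ε • fun κ u κ' u' => sgnK (trK ((fun κ u κ' u' => (cE₂ * (Lc : ℝ) ^ (2 * (d + 1))) • mmRead Lc (K3OfK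
            (unitK (sfStep Lc (l + 1)) (smStep d Lc (l + 1)) (GcombSh (d := d) Lc (l + 1))) Lc
            (unitS (sfStep Lc (l + 1)) (smStep d Lc (l + 1)) (SpureCombOf tabs cE cVH cΛ (l + 1))) (unitM (sfStep Lc (l + 1)) (smStep d Lc (l + 1)) (tabs.M (l + 1)))
            (W2SymOfK (unitK (sfStep Lc (l + 1)) (smStep d Lc (l + 1)) (GcombSh (d := d) Lc (l + 1))) Lc
              (unitS (sfStep Lc (l + 1)) (smStep d Lc (l + 1)) (SpureCombOf tabs cE cVH cΛ (l + 1))) (unitM (sfStep Lc (l + 1)) (smStep d Lc (l + 1)) (tabs.M (l + 1))) 0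
              (unitM₂ (sfStep Lc (l + 1)) (smStep d Lc (l + 1)) (M2Of d Lc tabs.mixFF (l + 1)))) κ u κ' u') + cB • tabs.vh₂S κ u κ' u') κ u κ' u'))))
        - ((1 / 2 : ℝ) • ((fun κ u κ' u' => (cE₂ * (Lc : ℝ) ^ (2 * (d + 1))) • mmRead Lc (K3OfK
            (unitK (sfStep Lc l) (smStep d Lc l) (GcombSh (d := d) Lc l)) Lc
            (unitS (sfStep Lc l) (smStep d Lc l) (SpureCombOf tabs cE cVH cΛ l)) (unitM (sfStep Lc l) (smStep d Lc l) (tabs.M l))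
            (W2SymOfK (unitK (sfStep Lc l) (smStep d Lc l) (GcombSh (d := d) Lc l)) Lc
              (unitS (sfStep Lc l) (smStep d Lc l) (SpureCombOf tabs cE cVH cΛ l)) (unitM (sfStep Lc l) (smStep d Lc l) (tabs.M l)) 0
              (unitM₂ (sfStep Lc l) (smStep d Lc l) (M2Of d Lc tabs.mixFF l))) κ u κ' u') + cB • tabs.vh₂S κ u κ' u')
          + ε • fun κ u κ' u' => sgnK (trK ((fun κ u κ' u' => (cE₂ * (Lc : ℝ) ^ (2 * (d + 1))) • mmRead Lc (K3OfK
            (unitK (sfStep Lc l) (smStep d Lc l) (GcombSh (d := d) Lc l)) Lc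
            (unitS (sfStep Lc l) (smStep d Lc l) (SpureCombOf tabs cE cVH cΛ l)) (unitM (sfStep Lc l) (smStep d Lc l) (tabs.M l))
            (W2SymOfK (unitK (sfStep Lc l) (smStep d Lc l) (GcombSh (d := d) Lc l)) Lc
              (unitS (sfStep Lc l) (smStep d Lc l) (SpureCombOf tabs cE cVH cΛ l)) (unitM (sfStep Lc l) (smStep d Lc l) (tabs.M l)) 0
              (unitM₂ (sfStep Lc l) (smStep d Lc l) (M2Of d Lc tabs.mixFF l))) κ u κ' u') + cB • tabs.vh₂S κ u κ' u') κ u κ' u'))))) Cbd δ := by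
    rw [half_sub]
    exact locStencil₂_halfTable hbF4d hε
  have hA : LocStencil₂ (fun (_ : Fin (d + 1)) (p : Fin (d + 1) → ℤ) (κ' : Fin (d + 1)) (u' : Fin (d + 1) → ℤ) =>
      divV (fun κ₁ u₁ => (((1 / 2 : ℝ) • ((fun κ u κ' u' => (cE₂ * (Lc : ℝ) ^ (2 * (d + 1))) • mmRead Lc (K3OfK
            (unitK (sfStep Lc (l + 1)) (smStep d Lc (l + 1)) (GcombSh (d := d) Lc (l + 1))) Lc
            (unitS (sfStep Lc (l + 1)) (smStep d Lc (l + 1)) (SpureCombOf tabs cE cVH cΛ (l + 1))) (unitM (sfStep Lc (l + 1)) (smStep d Lc (l + 1)) (tabs.M (l + 1)))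
            (W2SymOfK (unitK (sfStep Lc (l + 1)) (smStep d Lc (l + 1)) (GcombSh (d := d) Lc (l + 1))) Lc
              (unitS (sfStep Lc (l + 1)) (smStep d Lc (l + 1)) (SpureCombOf tabs cE cVH cΛ (l + 1))) (unitM (sfStep Lc (l + 1)) (smStep d Lc (l + 1)) (tabs.M (l + 1))) 0
              (unitM₂ (sfStep Lc (l + 1)) (smStep d Lc (l + 1)) (M2Of d Lc tabs.mixFF (l + 1)))) κ u κ' u') + cB • tabs.vh₂S κ u κ' u')
          + ε • fun κ u κ' u' => sgnK (trK ((fun κ u κ' u' => (cE₂ * (Lc : ℝ) ^ (2 * (d + 1))) • mmRead Lc (K3OfK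
            (unitK (sfStep Lc (l + 1)) (smStep d Lc (l + 1)) (GcombSh (d := d) Lc (l + 1))) Lc
            (unitS (sfStep Lc (l + 1)) (smStep d Lc (l + 1)) (SpureCombOf tabs cE cVH cΛ (l + 1))) (unitM (sfStep Lc (l + 1)) (smStep d Lc (l + 1)) (tabs.M (l + 1)))
            (W2SymOfK (unitK (sfStep Lc (l + 1)) (smStep d Lc (l + 1)) (GcombSh (d := d) Lc (l + 1))) Lc
              (unitS (sfStep Lc (l + 1)) (smStep d Lc (l + 1)) (SpureCombOf tabs cE cVH cΛ (l + 1))) (unitM (sfStep Lc (l + 1)) (smStep d Lc (l + 1)) (tabs.M (l + 1))) 0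
              (unitM₂ (sfStep Lc (l + 1)) (smStep d Lc (l + 1)) (M2Of d Lc tabs.mixFF (l + 1)))) κ u κ' u') + cB • tabs.vh₂S κ u κ' u') κ u κ' u'))))
        - ((1 / 2 : ℝ) • ((fun κ u κ' u' => (cE₂ * (Lc : ℝ) ^ (2 * (d + 1))) • mmRead Lc (K3OfK
            (unitK (sfStep Lc l) (smStep d Lc l) (GcombSh (d := d) Lc l)) Lc
            (unitS (sfStep Lc l) (smStep d Lc l) (SpureCombOf tabs cE cVH cΛ l)) (unitM (sfStep Lc l) (smStep d Lc l) (tabs.M l))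
            (W2SymOfK (unitK (sfStep Lc l) (smStep d Lc l) (GcombSh (d := d) Lc l)) Lc
              (unitS (sfStep Lc l) (smStep d Lc l) (SpureCombOf tabs cE cVH cΛ l)) (unitM (sfStep Lc l) (smStep d Lc l) (tabs.M l)) 0
              (unitM₂ (sfStep Lc l) (smStep d Lc l) (M2Of d Lc tabs.mixFF l))) κ u κ' u') + cB • tabs.vh₂S κ u κ' u')
          + ε • fun κ u κ' u' => sgnK (trK ((fun κ u κ' u' => (cE₂ * (Lc : ℝ) ^ (2 * (d + 1))) • mmRead Lc (K3OfK
            (unitK (sfStep Lc l) (smStep d Lc l) (GcombSh (d := d) Lc l)) Lc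
            (unitS (sfStep Lc l) (smStep d Lc l) (SpureCombOf tabs cE cVH cΛ l)) (unitM (sfStep Lc l) (smStep d Lc l) (tabs.M l))
            (W2SymOfK (unitK (sfStep Lc l) (smStep d Lc l) (GcombSh (d := d) Lc l)) Lc
              (unitS (sfStep Lc l) (smStep d Lc l) (SpureCombOf tabs cE cVH cΛ l)) (unitM (sfStep Lc l) (smStep d Lc l) (tabs.M l)) 0
              (unitM₂ (sfStep Lc l) (smStep d Lc l) (M2Of d Lc tabs.mixFF l))) κ u κ' u') + cB • tabs.vh₂S κ u κ' u') κ u κ' u'))))) κ₁ u₁ κ' u') p) (((d : ℝ) + 1) * (Real.exp (3 * δ) + 1) * Cbd) δ :=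
    fun _ p κ' u' x z a b => letter_fst_of_locStencil₂ hbd hδ p κ' u' x z a b
  have e : (fun (_ : Fin (d + 1)) (p : Fin (d + 1) → ℤ) (κ' : Fin (d + 1)) (u' : Fin (d + 1) → ℤ) =>
        divV (fun κ₁ u₁ => (((1 / 2 : ℝ) • (unitS₂ (sfStep Lc (l + 1 + 1)) (smStep d Lc (l + 1 + 1)) (T2RecOf d Lc (GcombSh Lc) (SpureCombOf tabs cE cVH cΛ) tabs.M cE₂ cB Tc tabs.vh₂S tabs.mixFF (l + 1 + 1))
          + ε • fun κ u κ' u' => sgnK (trK (unitS₂ (sfStep Lc (l + 1 + 1)) (smStep d Lc (l + 1 + 1)) (T2RecOf d Lc (GcombSh Lc) (SpureCombOf tabs cE cVH cΛ) tabs.M cE₂ cB Tc tabs.vh₂S tabs.mixFF (l + 1 + 1)) κ u κ' u'))))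
        - ((1 / 2 : ℝ) • (unitS₂ (sfStep Lc (l + 1)) (smStep d Lc (l + 1)) (T2RecOf d Lc (GcombSh Lc) (SpureCombOf tabs cE cVH cΛ) tabs.M cE₂ cB Tc tabs.vh₂S tabs.mixFF (l + 1))
          + ε • fun κ u κ' u' => sgnK (trK (unitS₂ (sfStep Lc (l + 1)) (smStep d Lc (l + 1)) (T2RecOf d Lc (GcombSh Lc) (SpureCombOf tabs cE cVH cΛ) tabs.M cE₂ cB Tc tabs.vh₂S tabs.mixFF (l + 1)) κ u κ' u'))))) κ₁ u₁ κ' u') p)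
      = (fun (_ : Fin (d + 1)) (p : Fin (d + 1) → ℤ) (κ' : Fin (d + 1)) (u' : Fin (d + 1) → ℤ) =>
          divV (fun κ₁ u₁ => (((1 / 2 : ℝ) • ((fun κ u κ' u' => (cE₂ * (Lc : ℝ) ^ (2 * (d + 1))) • mmRead Lc (K3OfK
            (unitK (sfStep Lc (l + 1)) (smStep d Lc (l + 1)) (GcombSh (d := d) Lc (l + 1))) Lc
            (unitS (sfStep Lc (l + 1)) (smStep d Lc (l + 1)) (SpureCombOf tabs cE cVH cΛ (l + 1))) (unitM (sfStep Lc (l + 1)) (smStep d Lc (l + 1)) (tabs.M (l + 1)))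
            (W2SymOfK (unitK (sfStep Lc (l + 1)) (smStep d Lc (l + 1)) (GcombSh (d := d) Lc (l + 1))) Lc
              (unitS (sfStep Lc (l + 1)) (smStep d Lc (l + 1)) (SpureCombOf tabs cE cVH cΛ (l + 1))) (unitM (sfStep Lc (l + 1)) (smStep d Lc (l + 1)) (tabs.M (l + 1))) 0
              (unitM₂ (sfStep Lc (l + 1)) (smStep d Lc (l + 1)) (M2Of d Lc tabs.mixFF (l + 1)))) κ u κ' u') + cB • tabs.vh₂S κ u κ' u')
          + ε • fun κ u κ' u' => sgnK (trK ((fun κ u κ' u' => (cE₂ * (Lc : ℝ) ^ (2 * (d + 1))) • mmRead Lc (K3OfK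
            (unitK (sfStep Lc (l + 1)) (smStep d Lc (l + 1)) (GcombSh (d := d) Lc (l + 1))) Lc
            (unitS (sfStep Lc (l + 1)) (smStep d Lc (l + 1)) (SpureCombOf tabs cE cVH cΛ (l + 1))) (unitM (sfStep Lc (l + 1)) (smStep d Lc (l + 1)) (tabs.M (l + 1)))
            (W2SymOfK (unitK (sfStep Lc (l + 1)) (smStep d Lc (l + 1)) (GcombSh (d := d) Lc (l + 1))) Lc
              (unitS (sfStep Lc (l + 1)) (smStep d Lc (l + 1)) (SpureCombOf tabs cE cVH cΛ (l + 1))) (unitM (sfStep Lc (l + 1)) (smStep d Lc (l + 1)) (tabs.M (l + 1))) 0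
              (unitM₂ (sfStep Lc (l + 1)) (smStep d Lc (l + 1)) (M2Of d Lc tabs.mixFF (l + 1)))) κ u κ' u') + cB • tabs.vh₂S κ u κ' u') κ u κ' u'))))
        - ((1 / 2 : ℝ) • ((fun κ u κ' u' => (cE₂ * (Lc : ℝ) ^ (2 * (d + 1))) • mmRead Lc (K3OfK
            (unitK (sfStep Lc l) (smStep d Lc l) (GcombSh (d := d) Lc l)) Lc
            (unitS (sfStep Lc l) (smStep d Lc l) (SpureCombOf tabs cE cVH cΛ l)) (unitM (sfStep Lc l) (smStep d Lc l) (tabs.M l))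
            (W2SymOfK (unitK (sfStep Lc l) (smStep d Lc l) (GcombSh (d := d) Lc l)) Lc
              (unitS (sfStep Lc l) (smStep d Lc l) (SpureCombOf tabs cE cVH cΛ l)) (unitM (sfStep Lc l) (smStep d Lc l) (tabs.M l)) 0
              (unitM₂ (sfStep Lc l) (smStep d Lc l) (M2Of d Lc tabs.mixFF l))) κ u κ' u') + cB • tabs.vh₂S κ u κ' u')
          + ε • fun κ u κ' u' => sgnK (trK ((fun κ u κ' u' => (cE₂ * (Lc : ℝ) ^ (2 * (d + 1))) • mmRead Lc (K3OfK
            (unitK (sfStep Lc l) (smStep d Lc l) (GcombSh (d := d) Lc l)) Lc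
            (unitS (sfStep Lc l) (smStep d Lc l) (SpureCombOf tabs cE cVH cΛ l)) (unitM (sfStep Lc l) (smStep d Lc l) (tabs.M l))
            (W2SymOfK (unitK (sfStep Lc l) (smStep d Lc l) (GcombSh (d := d) Lc l)) Lc
              (unitS (sfStep Lc l) (smStep d Lc l) (SpureCombOf tabs cE cVH cΛ l)) (unitM (sfStep Lc l) (smStep d Lc l) (tabs.M l)) 0
              (unitM₂ (sfStep Lc l) (smStep d Lc l) (M2Of d Lc tabs.mixFF l))) κ u κ' u') + cB • tabs.vh₂S κ u κ' u') κ u κ' u'))))) κ₁ u₁ κ' u') p)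
        + (fun (_ : Fin (d + 1)) (p : Fin (d + 1) → ℤ) (κ' : Fin (d + 1)) (u' : Fin (d + 1) → ℤ) =>
          (cE₂ * (Lc : ℝ) ^ (2 * (d + 1)) * ((Lc : ℝ) ^ (d + 1))⁻¹ / 2) •
            (e3OfK Lc (unitK (sfStep Lc (l + 1)) (smStep d Lc (l + 1)) (GcombSh (d := d) Lc (l + 1)))
              (fun κ' u' => (sfStep Lc (l + 1) * smStep d Lc (l + 1))⁻¹ • unitS (sfStep Lc (l + 1)) (smStep d Lc (l + 1))
                (fun κ' u' => cH₁⁻¹ • ((((1 : ℝ) + ε) / 2) • (comp (S₁ κ' u') (X p) - comp (X p) (S₁ κ' u')) + (((1 : ℝ) - ε) / 2) • R₁ p κ' u')) κ' u') κ' u'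
            + e3OfK Lc (unitK (sfStep Lc (l + 1)) (smStep d Lc (l + 1)) (GcombSh (d := d) Lc (l + 1)))
              (fun κ u => (sfStep Lc (l + 1) * smStep d Lc (l + 1))⁻¹ • unitS (sfStep Lc (l + 1)) (smStep d Lc (l + 1))
                (fun κ u => cH₁⁻¹ • ((((1 : ℝ) + ε) / 2) • (comp (S₁ κ u) (X p) - comp (X p) (S₁ κ u)) + (((1 : ℝ) - ε) / 2) • R₁'' p κ u)) κ u) κ' u')
        - (cE₂ * (Lc : ℝ) ^ (2 * (d + 1)) * ((Lc : ℝ) ^ (d + 1))⁻¹ / 2) •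
            (e3OfK Lc (unitK (sfStep Lc l) (smStep d Lc l) (GcombSh (d := d) Lc l))
              (fun κ' u' => (sfStep Lc l * smStep d Lc l)⁻¹ • unitS (sfStep Lc l) (smStep d Lc l)
                (fun κ' u' => cH₀⁻¹ • ((((1 : ℝ) + ε) / 2) • (comp (S₀ κ' u') (X p) - comp (X p) (S₀ κ' u')) + (((1 : ℝ) - ε) / 2) • R₀ p κ' u')) κ' u') κ' u'
            + e3OfK Lc (unitK (sfStep Lc l) (smStep d Lc l) (GcombSh (d := d) Lc l))
              (fun κ u => (sfStep Lc l * smStep d Lc l)⁻¹ • unitS (sfStep Lc l) (smStep d Lc l)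
                (fun κ u => cH₀⁻¹ • ((((1 : ℝ) + ε) / 2) • (comp (S₀ κ u) (X p) - comp (X p) (S₀ κ u)) + (((1 : ℝ) - ε) / 2) • R₀'' p κ u)) κ u) κ' u')) := by
    funext i p κ' u'
    have h₁ : divV (fun κ₁ u₁ => ((1 / 2 : ℝ) • (unitS₂ (sfStep Lc (l + 1 + 1)) (smStep d Lc (l + 1 + 1)) (T2RecOf d Lc (GcombSh Lc) (SpureCombOf tabs cE cVH cΛ) tabs.M cE₂ cB Tc tabs.vh₂S tabs.mixFF (l + 1 + 1))
          + ε • fun κ u κ' u' => sgnK (trK (unitS₂ (sfStep Lc (l + 1 + 1)) (smStep d Lc (l + 1 + 1)) (T2RecOf d Lc (GcombSh Lc) (SpureCombOf tabs cE cVH cΛ) tabs.M cE₂ cB Tc tabs.vh₂S tabs.mixFF (l + 1 + 1)) κ u κ' u')))) κ₁ u₁ κ' u') p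
        = divV (fun κ₁ u₁ => ((1 / 2 : ℝ) • ((fun κ u κ' u' => (cE₂ * (Lc : ℝ) ^ (2 * (d + 1))) • mmRead Lc (K3OfK
            (unitK (sfStep Lc (l + 1)) (smStep d Lc (l + 1)) (GcombSh (d := d) Lc (l + 1))) Lc
            (unitS (sfStep Lc (l + 1)) (smStep d Lc (l + 1)) (SpureCombOf tabs cE cVH cΛ (l + 1))) (unitM (sfStep Lc (l + 1)) (smStep d Lc (l + 1)) (tabs.M (l + 1)))
            (W2SymOfK (unitK (sfStep Lc (l + 1)) (smStep d Lc (l + 1)) (GcombSh (d := d) Lc (l + 1))) Lc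
              (unitS (sfStep Lc (l + 1)) (smStep d Lc (l + 1)) (SpureCombOf tabs cE cVH cΛ (l + 1))) (unitM (sfStep Lc (l + 1)) (smStep d Lc (l + 1)) (tabs.M (l + 1))) 0
              (unitM₂ (sfStep Lc (l + 1)) (smStep d Lc (l + 1)) (M2Of d Lc tabs.mixFF (l + 1)))) κ u κ' u') + cB • tabs.vh₂S κ u κ' u')
          + ε • fun κ u κ' u' => sgnK (trK ((fun κ u κ' u' => (cE₂ * (Lc : ℝ) ^ (2 * (d + 1))) • mmRead Lc (K3OfK
            (unitK (sfStep Lc (l + 1)) (smStep d Lc (l + 1)) (GcombSh (d := d) Lc (l + 1))) Lc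
            (unitS (sfStep Lc (l + 1)) (smStep d Lc (l + 1)) (SpureCombOf tabs cE cVH cΛ (l + 1))) (unitM (sfStep Lc (l + 1)) (smStep d Lc (l + 1)) (tabs.M (l + 1)))
            (W2SymOfK (unitK (sfStep Lc (l + 1)) (smStep d Lc (l + 1)) (GcombSh (d := d) Lc (l + 1))) Lc
              (unitS (sfStep Lc (l + 1)) (smStep d Lc (l + 1)) (SpureCombOf tabs cE cVH cΛ (l + 1))) (unitM (sfStep Lc (l + 1)) (smStep d Lc (l + 1)) (tabs.M (l + 1))) 0
              (unitM₂ (sfStep Lc (l + 1)) (smStep d Lc (l + 1)) (M2Of d Lc tabs.mixFF (l + 1)))) κ u κ' u') + cB • tabs.vh₂S κ u κ' u') κ u κ' u')))) κ₁ u₁ κ' u') p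
          + (cE₂ * (Lc : ℝ) ^ (2 * (d + 1)) * ((Lc : ℝ) ^ (d + 1))⁻¹ / 2) •
            (e3OfK Lc (unitK (sfStep Lc (l + 1)) (smStep d Lc (l + 1)) (GcombSh (d := d) Lc (l + 1)))
              (fun κ' u' => (sfStep Lc (l + 1) * smStep d Lc (l + 1))⁻¹ • unitS (sfStep Lc (l + 1)) (smStep d Lc (l + 1))
                (fun κ' u' => cH₁⁻¹ • ((((1 : ℝ) + ε) / 2) • (comp (S₁ κ' u') (X p) - comp (X p) (S₁ κ' u')) + (((1 : ℝ) - ε) / 2) • R₁ p κ' u')) κ' u') κ' u'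
            + e3OfK Lc (unitK (sfStep Lc (l + 1)) (smStep d Lc (l + 1)) (GcombSh (d := d) Lc (l + 1)))
              (fun κ u => (sfStep Lc (l + 1) * smStep d Lc (l + 1))⁻¹ • unitS (sfStep Lc (l + 1)) (smStep d Lc (l + 1))
                (fun κ u => cH₁⁻¹ • ((((1 : ℝ) + ε) / 2) • (comp (S₁ κ u) (X p) - comp (X p) (S₁ κ u)) + (((1 : ℝ) - ε) / 2) • R₁'' p κ u)) κ u) κ' u') :=
      divW_halfMember_comb_succ_eq_slaved tabs cE cVH cΛ cE₂ cB Tc hBff hBmm (l + 1) hcH₁ hTL₁ hTL₁'' hC₁ hR₁ hR₁'' ε p κ' u'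
    have h₀ : divV (fun κ₁ u₁ => ((1 / 2 : ℝ) • (unitS₂ (sfStep Lc (l + 1)) (smStep d Lc (l + 1)) (T2RecOf d Lc (GcombSh Lc) (SpureCombOf tabs cE cVH cΛ) tabs.M cE₂ cB Tc tabs.vh₂S tabs.mixFF (l + 1))
          + ε • fun κ u κ' u' => sgnK (trK (unitS₂ (sfStep Lc (l + 1)) (smStep d Lc (l + 1)) (T2RecOf d Lc (GcombSh Lc) (SpureCombOf tabs cE cVH cΛ) tabs.M cE₂ cB Tc tabs.vh₂S tabs.mixFF (l + 1)) κ u κ' u')))) κ₁ u₁ κ' u') p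
        = divV (fun κ₁ u₁ => ((1 / 2 : ℝ) • ((fun κ u κ' u' => (cE₂ * (Lc : ℝ) ^ (2 * (d + 1))) • mmRead Lc (K3OfK
            (unitK (sfStep Lc l) (smStep d Lc l) (GcombSh (d := d) Lc l)) Lc
            (unitS (sfStep Lc l) (smStep d Lc l) (SpureCombOf tabs cE cVH cΛ l)) (unitM (sfStep Lc l) (smStep d Lc l) (tabs.M l))
            (W2SymOfK (unitK (sfStep Lc l) (smStep d Lc l) (GcombSh (d := d) Lc l)) Lc
              (unitS (sfStep Lc l) (smStep d Lc l) (SpureCombOf tabs cE cVH cΛ l)) (unitM (sfStep Lc l) (smStep d Lc l) (tabs.M l)) 0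
              (unitM₂ (sfStep Lc l) (smStep d Lc l) (M2Of d Lc tabs.mixFF l))) κ u κ' u') + cB • tabs.vh₂S κ u κ' u')
          + ε • fun κ u κ' u' => sgnK (trK ((fun κ u κ' u' => (cE₂ * (Lc : ℝ) ^ (2 * (d + 1))) • mmRead Lc (K3OfK
            (unitK (sfStep Lc l) (smStep d Lc l) (GcombSh (d := d) Lc l)) Lc
            (unitS (sfStep Lc l) (smStep d Lc l) (SpureCombOf tabs cE cVH cΛ l)) (unitM (sfStep Lc l) (smStep d Lc l) (tabs.M l))
            (W2SymOfK (unitK (sfStep Lc l) (smStep d Lc l) (GcombSh (d := d) Lc l)) Lc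
              (unitS (sfStep Lc l) (smStep d Lc l) (SpureCombOf tabs cE cVH cΛ l)) (unitM (sfStep Lc l) (smStep d Lc l) (tabs.M l)) 0
              (unitM₂ (sfStep Lc l) (smStep d Lc l) (M2Of d Lc tabs.mixFF l))) κ u κ' u') + cB • tabs.vh₂S κ u κ' u') κ u κ' u')))) κ₁ u₁ κ' u') p
          + (cE₂ * (Lc : ℝ) ^ (2 * (d + 1)) * ((Lc : ℝ) ^ (d + 1))⁻¹ / 2) •
            (e3OfK Lc (unitK (sfStep Lc l) (smStep d Lc l) (GcombSh (d := d) Lc l))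
              (fun κ' u' => (sfStep Lc l * smStep d Lc l)⁻¹ • unitS (sfStep Lc l) (smStep d Lc l)
                (fun κ' u' => cH₀⁻¹ • ((((1 : ℝ) + ε) / 2) • (comp (S₀ κ' u') (X p) - comp (X p) (S₀ κ' u')) + (((1 : ℝ) - ε) / 2) • R₀ p κ' u')) κ' u') κ' u'
            + e3OfK Lc (unitK (sfStep Lc l) (smStep d Lc l) (GcombSh (d := d) Lc l))
              (fun κ u => (sfStep Lc l * smStep d Lc l)⁻¹ • unitS (sfStep Lc l) (smStep d Lc l)
                (fun κ u => cH₀⁻¹ • ((((1 : ℝ) + ε) / 2) • (comp (S₀ κ u) (X p) - comp (X p) (S₀ κ u)) + (((1 : ℝ) - ε) / 2) • R₀'' p κ u)) κ u) κ' u') :=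
      divW_halfMember_comb_succ_eq_slaved tabs cE cVH cΛ cE₂ cB Tc hBff hBmm l hcH₀ hTL₀ hTL₀'' hC₀ hR₀ hR₀'' ε p κ' u'
    simp only [Pi.add_apply]
    rw [divV_fst_sub, divV_fst_sub, h₁, h₀]
    abel
  rw [e]
  exact locStencil₂_add hA hEd₁

end Summit.QuantumFields.BalabanUV.Beta.GAN24.CombHalfMemberSlavedDivergenceDrift

end
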